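import Literature.AlgebraicGeometry.Motives.HodgeStructureLefschetzGroupCenterFieldExtension
import Literature.AlgebraicGeometry.Motives.HodgeStructureEndAlgCentralizerInvolutionMatrixPairs
import HarnessLib

/-!
# REMARK 1.6 «`C'(A) ≅ C(A) ⊗_k k'`» FOR THE ALGEBRA WITH INVOLUTION `(C(A) ⊗ k, †)`: AN INJECTIVE `*`-RING HOMOMORPHISM
# `Φ : C(H)(K) → C(H)(L)` OVER `j`, SEMILINEAR OVER `K → L`, WHOSE RANGE SPANS `C(H)(L)` OVER `L`, WITH `Φ(c†) = Φ(c)†`,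
# `Φ(S(H)(K)) = γ ↦ γ_L` AND `Φ⁻¹ Z(C(H)(L)) = Z(C(H)(K))` (Milne 1999 §1 p. 642 `β ↦ β†`, p. 643 «`C(A)` stable under `†`»,
# Remark 1.6, Prop. 1.7 «isomorphism … of algebras with involution»)

[topic AlgebraicGeometry/Motives]

Layer `Literature/AlgebraicGeometry/Motives`, lane `lit-hodgefound` (Track 2 foundations library; prover seat
`lit-hodgefound-p02`, generation 56, self-proposed row g56-#4). THEOREMS ONLY: no definition, no named fact (net debt `0`),
no instance, no notation.  Completes the `K → L` picture of g56-#1 ∕ #2 ∕ #3 (centre `C₀ ⊗ K`, centre of `S`, factors) by the FULL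
centralizer with its involution: Milne's `C(A)` is «the centralizer of `End⁰(A) ⊗_ℚ k` in `End_k(V(A))`», a `k`-algebra «stable
under the involution `†`» (`e_D(βx, y) = e_D(x, β†y)`), `S(A)(R) = {γ ∈ C(A) ⊗_k R | γ†γ = 1}`, and Remark 1.6 ∕ Prop. 1.7 compare
two coefficient fields through an isomorphism «of algebras with involution».  On points the tree has `C(H)(K)`, Milne's `†_K`
(`Polarization.adjointBaseChange K`, `Motives/HodgeStructurePolarizationAdjointPoints`) and its restriction
`Polarization.centralizerAdjoint K : C(H)(K) → C(H)(K)` (`Motives/HodgeStructureEndAlgCentralizerInvolutionMatrixPairs`).  PROVED here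
for every polarized `ℚ`-Hodge structure `(H, ψ)` on a finite-dimensional `V` and fields `ℚ ⊆ K ⊆ L` (any universes), with the
`L`-extension `F` of `f` handled through `F ∘ j = j ∘ f` as in g56-#1:
(i) two `L`-bilinear forms on `L ⊗ V` agreeing on `j(K ⊗ V) × j(K ⊗ V)` are equal; hence **`†` COMMUTES WITH `K → L`**: `F^{†_L}`
extends `f^{†_K}` (`Q_L(j x, j y) = (K → L) Q_K(x, y)` and uniqueness of adjoints), and `F† F = 1 ⟺ f† f = 1`, `F† = F ⟺ f† = f`;
(ii) **an injective ring homomorphism `Φ : C(H)(K) → C(H)(L)` over `j`**, `Φ(c f) = (K → L)(c) Φ(f)`, whose RANGE SPANS `C(H)(L)`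
over `L` (`C(H)(L) = span_L {c_L | c ∈ C(H)}` and `c_L = Φ(c_K)`) — the points form of «`C'(A) ≅ C(A) ⊗_k k'`»;
(iii) for ANY such `Φ`: `Φ(c†) = Φ(c)†` (`*`-homomorphism), `†`-symmetry and `†`-unitarity are detected by `Φ`, `Φ(↑γ) = ↑γ_L` for
`γ ∈ S(H)(K)` (compatibility with `γ ↦ γ_L` of `Motives/HodgeStructureLefschetzGroupFieldExtension`), and
`Φ(c) ∈ Z(C(H)(L)) ⟺ c ∈ Z(C(H)(K))` (compatibility with the centre map of g56-#1).

## The sources, verbatim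

* J. S. Milne, *Lefschetz classes on abelian varieties*, Duke Math. J. 96 (1999) 639–675 [Milne1999LefschetzClasses] (held
  `paper:doi-10-1215-s0012-7094-99-09620-5`): folio 4 = p. 642 L64–L70 «we let `β†` denote the adjoint with respect to `e_D` of a
  `k`-linear endomorphism `β` of `V(A)`: `e_D(βx, y) = e_D(x, β†y)` … `β ↦ β†` is an involution of the `k`-algebra `End_k(V(A))`»;
  folio 5 = p. 643 L1–L6 «`C(A)` … the centralizer of `End⁰(A) ⊗_ℚ k` in `End_k(V(A))` … stable under the involution `†`»,
  Prop. 1.3; folio 6 = p. 644 L16–L20 «`S(A)(R) = {γ ∈ C(A) ⊗_k R | γ†γ = 1}`», L30–L37 «**Remark 1.6.** … canonical isomorphisms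
  `C'(A) ≅ C(A) ⊗_k k'`, `S'(A) ≅ S(A)_{/k'}`»; folio 7 = p. 645 Prop. 1.7 «an isomorphism `C₀(A) ⊗_ℚ ℚ_ℓ → C_ℓ(A)` of
  `ℚ_ℓ`-algebras with involution».
* P. Deligne, *Hodge cycles on abelian varieties*, LNM 900 (1982) [Deligne1982HodgeCycles], I §3.1, proof of Prop. 3.1 (centralizers
  and extension of scalars).
* N. Bourbaki, *Algebra I* [BourbakiAlgebraI1989], Ch. II §5 no. 1, no. 3 Prop. 7, §7 no. 7; *Algebra* Ch. IX §1 no. 4 (extension of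
  scalars of bilinear forms).

Nearest tree results, BY NAME: `Polarization.adjointBaseChange`, `eq_adjointBaseChange_of_isAdjointPair`,
`baseChange_form_apply_adjointBaseChange` (`Motives/HodgeStructurePolarizationAdjointPoints`); `Polarization.centralizerAdjoint`,
`coe_centralizerAdjoint`; `baseChange_extendScalars_extendScalars` (`Q_L(j x, j y) = (K → L) Q_K(x, y)`),
`glExtendScalars_extendScalars`; `forall_baseChange_comm_iff_mem_span_baseChange_centralizer` (`C(H)(L) = span_L {c_L}`); g56-#1
`exists_linearMap_extendScalars_comm` ∕ `linearMap_eq_of_extendScalars_comm` ∕ `mem_centralizer_endAlg_baseChange_iff_of_extendScalars_comm` ∕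
`mem_center_centralizer_iff_of_extendScalars_comm` ∕ `exists_center_centralizer_ringHom_injective` (the centre only); g56-#2
`coe_glExtendScalars_extendScalars`.

## Dictionary and what is proved

`j = extendScalars K L V`, `†_K = ψ.adjointBaseChange K`, `C(H)(K) = Subalgebra.centralizer K {a_K | a ∈ E_φ}`, "`Φ` over `j`" =
`∀ f x, (Φ f).1 (j x) = j (f.1 x)`.

* §1 (namespace `…Motives`) **`bilinForm_ext_of_extendScalars`**.
* §2 (namespace `…Motives.HodgeStructure`) **`Polarization.adjointBaseChange_extendScalars_comm`** (`F†` extends `f†`),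
  **`Polarization.adjointBaseChange_mul_self_eq_one_iff_of_extendScalars_comm`**, **`Polarization.adjointBaseChange_eq_self_iff_of_extendScalars_comm`**.
* §3 **`exists_centralizer_ringHom_injective_extendScalars_comm`** (`Φ`), **`span_range_eq_centralizer_of_extendScalars_comm`**,
  **`Polarization.map_centralizerAdjoint_eq_of_extendScalars_comm`** (`Φ(c†) = Φ(c)†`),
  **`Polarization.centralizerAdjoint_map_eq_iff_of_extendScalars_comm`**, **`Polarization.map_coe_eq_coe_glExtendScalars`**,
  `Polarization.coe_mem_centralizer_endAlg_baseChange`, **`map_mem_center_centralizer_iff_of_extendScalars_comm`**.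
-/

noncomputable section

open scoped TensorProduct

namespace Literature.AlgebraicGeometry.Motives

universe u u' v

/-! ## §1 Bilinear forms: two `L`-bilinear forms on `L ⊗ V` agreeing on `j(K ⊗ V) × j(K ⊗ V)` are equal -/

section Bilinear

variable (K : Type u) (L : Type u') [Field K] [Field L] [Algebra ℚ K] [Algebra ℚ L] [Algebra K L]
  [IsScalarTower ℚ K L] (V : Type v) [AddCommGroup V] [Module ℚ V]

/-- **Two `L`-bilinear forms on `L ⊗_ℚ V` agreeing on `j(K ⊗ V) × j(K ⊗ V)` are equal** (`L ⊗ V` is spanned over `L` by `j(K ⊗ V)`,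
twice). [cite: BourbakiAlgebraI1989, Ch. II §7 no. 7] -/
theorem bilinForm_ext_of_extendScalars {B₁ B₂ : LinearMap.BilinForm L (L ⊗[ℚ] V)}
    (h : ∀ x y : K ⊗[ℚ] V, B₁ (extendScalars K L V x) (extendScalars K L V y) = B₂ (extendScalars K L V x) (extendScalars K L V y)) :
    B₁ = B₂ :=
  linearMap_ext_of_extendScalars K L V fun x => linearMap_ext_of_extendScalars K L V fun y => h x y

end Bilinear

namespace HodgeStructure

/-! ## §2 The adjoint `†` commutes with `K → L`: if `F` extends `f` then `F^{†_L}` extends `f^{†_K}` -/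

section Adjoint

variable (K : Type u) (L : Type u') [Field K] [Field L] [Algebra ℚ K] [Algebra ℚ L] [Algebra K L]
  [IsScalarTower ℚ K L] {V : Type v} [AddCommGroup V] [Module ℚ V] [Module.Finite ℚ V] {n : ℤ} {H : HodgeStructure V n}
  (ψ : Polarization H)

/-- **`†` COMMUTES WITH EXTENSION OF THE COEFFICIENT FIELD**: if `F` is the `L`-extension of `f` (`F ∘ j = j ∘ f`), then `F^{†_L}` is
the `L`-extension of `f^{†_K}` — `Q_L(F (j x), j y) = (K → L)(Q_K(f x, y)) = (K → L)(Q_K(x, f† y)) = Q_L(j x, j (f† y))`, and adjoints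
for the nondegenerate `Q_L` are unique («`C'(A) ≅ C(A) ⊗_k k'` … of `ℚ_ℓ`-algebras with involution»).
[cite: Milne1999LefschetzClasses, §1 p. 642 L64–L70, Remark 1.6 (p. 644) and Prop. 1.7 (p. 645)] -/
theorem Polarization.adjointBaseChange_extendScalars_comm {f : Module.End K (K ⊗[ℚ] V)} {F : Module.End L (L ⊗[ℚ] V)}
    (hF : ∀ x, F (extendScalars K L V x) = extendScalars K L V (f x)) (x : K ⊗[ℚ] V) :
    ψ.adjointBaseChange L F (extendScalars K L V x) = extendScalars K L V (ψ.adjointBaseChange K f x) := by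
  obtain ⟨G, hG⟩ := exists_linearMap_extendScalars_comm K L V (ψ.adjointBaseChange K f)
  have hadj : LinearMap.IsAdjointPair (ψ.form.baseChange L) (ψ.form.baseChange L) F G := by
    have hB : (ψ.form.baseChange L).compl₂ G = (ψ.form.baseChange L) ∘ₗ F := by
      refine bilinForm_ext_of_extendScalars K L V fun x y => ?_
      rw [LinearMap.compl₂_apply, LinearMap.comp_apply, hG, hF, baseChange_extendScalars_extendScalars,
        baseChange_extendScalars_extendScalars, ψ.baseChange_form_apply_adjointBaseChange K]
    intro x' y'
    have h := LinearMap.congr_fun (LinearMap.congr_fun hB x') y'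
    rw [LinearMap.compl₂_apply, LinearMap.comp_apply] at h
    exact h.symm
  rw [← ψ.eq_adjointBaseChange_of_isAdjointPair L hadj, hG]

/-- **`(f† f = 1) ⟹ (F† F = 1)` and conversely**: unitarity for `†_K` and for `†_L` correspond under `f ↦ F` («`γ†γ = 1`» is
compatible with `k ⊆ k'`). [cite: Milne1999LefschetzClasses, §1 p. 644 L16–L20 and Remark 1.6 (p. 644)] -/
theorem Polarization.adjointBaseChange_mul_self_eq_one_iff_of_extendScalars_comm {f : Module.End K (K ⊗[ℚ] V)}
    {F : Module.End L (L ⊗[ℚ] V)} (hF : ∀ x, F (extendScalars K L V x) = extendScalars K L V (f x)) :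
    ψ.adjointBaseChange L F * F = 1 ↔ ψ.adjointBaseChange K f * f = 1 := by
  have hext : ∀ x, (ψ.adjointBaseChange L F * F) (extendScalars K L V x) = extendScalars K L V ((ψ.adjointBaseChange K f * f) x) :=
    mul_extendScalars_comm K L V (ψ.adjointBaseChange_extendScalars_comm K L hF) hF
  have h1 : ∀ x, (1 : Module.End L (L ⊗[ℚ] V)) (extendScalars K L V x) = extendScalars K L V ((1 : Module.End K (K ⊗[ℚ] V)) x) :=
    fun x => rfl
  constructor
  · intro h
    exact eq_of_extendScalars_comm_of_extendScalars_comm K L V (fun x => by rw [← h]; exact hext x) h1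
  · intro h
    refine linearMap_eq_of_extendScalars_comm K L V hext fun x => ?_
    rw [h]
    rfl

/-- **`f† = f ⟺ F† = F`** (symmetry for `†` is insensitive to `k ⊆ k'`; Milne's Prop. 1.3 over the larger field).
[cite: Milne1999LefschetzClasses, §1 Prop. 1.3 (p. 643) and Remark 1.6 (p. 644)] -/
theorem Polarization.adjointBaseChange_eq_self_iff_of_extendScalars_comm {f : Module.End K (K ⊗[ℚ] V)}
    {F : Module.End L (L ⊗[ℚ] V)} (hF : ∀ x, F (extendScalars K L V x) = extendScalars K L V (f x)) :
    ψ.adjointBaseChange L F = F ↔ ψ.adjointBaseChange K f = f := by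
  have hext := ψ.adjointBaseChange_extendScalars_comm K L hF
  constructor
  · intro h
    exact eq_of_extendScalars_comm_of_extendScalars_comm K L V (fun x => by rw [← h]; exact hext x) hF
  · intro h
    refine linearMap_eq_of_extendScalars_comm K L V hext fun x => ?_
    rw [h, hF]

end Adjoint

/-! ## §3 «`C'(A) ≅ C(A) ⊗_k k'`» AS AN INJECTIVE `*`-RING HOMOMORPHISM `Φ : C(H)(K) → C(H)(L)` OVER `j` WHOSE RANGE SPANS `C(H)(L)` -/

section Algebra

variable (K : Type u) (L : Type u') [Field K] [Field L] [Algebra ℚ K] [Algebra ℚ L] [Algebra K L]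
  [IsScalarTower ℚ K L] {V : Type v} [AddCommGroup V] [Module ℚ V] [Module.Finite ℚ V] {n : ℤ} (H : HodgeStructure V n)

omit [Module.Finite ℚ V] in
/-- **THE INJECTIVE RING HOMOMORPHISM `Φ : C(H)(K) → C(H)(L)` OVER `j`, SEMILINEAR OVER `K → L`** — Remark 1.6 «`C'(A) ≅ C(A) ⊗_k k'`»
for the ALGEBRA on points: `Φ(f)` is the `L`-extension of `f`; `Φ` is a ring homomorphism (uniqueness of extensions), injective
(`j` injective), and `Φ(c f) = (K → L)(c) Φ(f)`.  (Existence form: no definition is introduced.)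
[cite: Milne1999LefschetzClasses, §1 Remark 1.6 (p. 644) and p. 643 L1–L3 (`C(A)`)] [cite: BourbakiAlgebraI1989, Ch. II §5 no. 1 and no. 3 Prop. 7] -/
theorem exists_centralizer_ringHom_injective_extendScalars_comm :
    ∃ Φ : Subalgebra.centralizer K ((fun a : Module.End ℚ V => a.baseChange K) '' (H.endAlg : Set (Module.End ℚ V))) →+*
        Subalgebra.centralizer L ((fun a : Module.End ℚ V => a.baseChange L) '' (H.endAlg : Set (Module.End ℚ V))),
      Function.Injective Φ ∧
      (∀ f x, ((Φ f).1 : Module.End L (L ⊗[ℚ] V)) (extendScalars K L V x) = extendScalars K L V ((f.1 : Module.End K (K ⊗[ℚ] V)) x)) ∧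
      ∀ (c : K) f, Φ (c • f) = algebraMap K L c • Φ f := by
  have key : ∀ f : Subalgebra.centralizer K ((fun a : Module.End ℚ V => a.baseChange K) '' (H.endAlg : Set (Module.End ℚ V))),
      ∃ F : Subalgebra.centralizer L ((fun a : Module.End ℚ V => a.baseChange L) '' (H.endAlg : Set (Module.End ℚ V))),
        ∀ x, (F.1 : Module.End L (L ⊗[ℚ] V)) (extendScalars K L V x) = extendScalars K L V ((f.1 : Module.End K (K ⊗[ℚ] V)) x) := by
    intro f
    obtain ⟨F, hF⟩ := exists_linearMap_extendScalars_comm K L V (f.1 : Module.End K (K ⊗[ℚ] V))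
    exact ⟨⟨F, (mem_centralizer_endAlg_baseChange_iff_of_extendScalars_comm K L H hF).2 f.2⟩, hF⟩
  choose Φ hΦ using key
  have hext : ∀ {f : Subalgebra.centralizer K ((fun a : Module.End ℚ V => a.baseChange K) '' (H.endAlg : Set (Module.End ℚ V)))}
      {F : Subalgebra.centralizer L ((fun a : Module.End ℚ V => a.baseChange L) '' (H.endAlg : Set (Module.End ℚ V)))},
      (∀ x, (F.1 : Module.End L (L ⊗[ℚ] V)) (extendScalars K L V x) = extendScalars K L V ((f.1 : Module.End K (K ⊗[ℚ] V)) x)) →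
        Φ f = F :=
    fun {f} {F} hF => Subtype.ext (linearMap_eq_of_extendScalars_comm K L V (hΦ f) hF)
  refine ⟨{ toFun := Φ,
            map_one' := hext fun x => by simp,
            map_mul' := fun f g => hext fun x => ?_,
            map_zero' := hext fun x => by simp,
            map_add' := fun f g => hext fun x => ?_ }, fun f g h => ?_, fun f x => hΦ f x, fun c f => hext fun x => ?_⟩
  · change (Φ f).1 ((Φ g).1 (extendScalars K L V x)) = extendScalars K L V (f.1 (g.1 x))
    rw [hΦ, hΦ]
  · change (Φ f).1 (extendScalars K L V x) + (Φ g).1 (extendScalars K L V x) = extendScalars K L V (f.1 x + g.1 x)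
    rw [hΦ, hΦ, map_add]
  · refine Subtype.ext (eq_of_extendScalars_comm_of_extendScalars_comm K L V (hΦ f) fun x => ?_)
    change (Φ f).1 (extendScalars K L V x) = _
    rw [show Φ f = Φ g from h, hΦ]
  · change algebraMap K L c • ((Φ f).1 (extendScalars K L V x)) = extendScalars K L V (c • f.1 x)
    rw [hΦ, extendScalars_smul_eq_algebraMap_smul]

/-- **THE RANGE OF ANY `Φ` OVER `j` SPANS `C(H)(L)` OVER `L`** (`C(H)(L) = span_L {c_L | c ∈ C(H)}` — the tree's
`forall_baseChange_comm_iff_mem_span_baseChange_centralizer` — and `c_L = Φ(c_K)`): `C'(A) = C(A) ⊗_k k'` is generated by the image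
of `C(A)`. [cite: Milne1999LefschetzClasses, §1 Remark 1.6 (p. 644)] [cite: Deligne1982HodgeCycles, I §3 Prop. 3.1 (proof)] -/
theorem span_range_eq_centralizer_of_extendScalars_comm
    (Φ : Subalgebra.centralizer K ((fun a : Module.End ℚ V => a.baseChange K) '' (H.endAlg : Set (Module.End ℚ V))) →+*
        Subalgebra.centralizer L ((fun a : Module.End ℚ V => a.baseChange L) '' (H.endAlg : Set (Module.End ℚ V))))
    (hΦ : ∀ f x, ((Φ f).1 : Module.End L (L ⊗[ℚ] V)) (extendScalars K L V x) =
      extendScalars K L V ((f.1 : Module.End K (K ⊗[ℚ] V)) x)) :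
    Submodule.span L (Set.range fun f => ((Φ f).1 : Module.End L (L ⊗[ℚ] V))) =
      Subalgebra.toSubmodule (Subalgebra.centralizer L
        ((fun a : Module.End ℚ V => a.baseChange L) '' (H.endAlg : Set (Module.End ℚ V)))) := by
  refine le_antisymm (Submodule.span_le.2 ?_) fun F hF => ?_
  · rintro _ ⟨f, rfl⟩
    exact (Φ f).2
  · -- `F ∈ C(H)(L) = span_L {c_L | c ∈ C(H)}`, and `c_L = Φ ⟨c_K, _⟩`
    have hF' : F ∈ Submodule.span L ((fun c : Module.End ℚ V => c.baseChange L) ''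
        (Subalgebra.centralizer ℚ (H.endAlg : Set (Module.End ℚ V)) : Set (Module.End ℚ V))) := by
      rw [← forall_baseChange_comm_iff_mem_span_baseChange_centralizer L (H.endAlg : Set (Module.End ℚ V)) F]
      intro s hs
      exact ((Subalgebra.mem_centralizer_iff L).1 hF _ ⟨s, hs, rfl⟩).symm
    refine Submodule.span_mono ?_ hF'
    rintro _ ⟨c, hc, rfl⟩
    have hcK : c.baseChange K ∈ Subalgebra.centralizer K
        ((fun a : Module.End ℚ V => a.baseChange K) '' (H.endAlg : Set (Module.End ℚ V))) := by
      rw [Subalgebra.mem_centralizer_iff]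
      rintro _ ⟨a, ha, rfl⟩
      rw [← LinearMap.baseChange_mul, ← LinearMap.baseChange_mul, (Subalgebra.mem_centralizer_iff ℚ).1 hc a ha]
    refine ⟨⟨c.baseChange K, hcK⟩, ?_⟩
    exact linearMap_eq_of_extendScalars_comm K L V (hΦ ⟨c.baseChange K, hcK⟩) fun x =>
      (extendScalars_baseChange_apply K L V c x).symm

/-- **`Φ` IS A `*`-HOMOMORPHISM: `Φ(c^{†_K}) = Φ(c)^{†_L}`** for Milne's involution restricted to the centralizer (the tree's
`Polarization.centralizerAdjoint`, «`C(A)` is a `k`-algebra stable under `†`») — «an isomorphism … of algebras with involution»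
(Prop. 1.7's form of Remark 1.6). [cite: Milne1999LefschetzClasses, §1 p. 642 L64–L70, p. 643 L5–L6, Remark 1.6 (p. 644) and Prop. 1.7 (p. 645)] -/
theorem Polarization.map_centralizerAdjoint_eq_of_extendScalars_comm {H : HodgeStructure V n} (ψ : Polarization H)
    (Φ : Subalgebra.centralizer K ((fun a : Module.End ℚ V => a.baseChange K) '' (H.endAlg : Set (Module.End ℚ V))) →+*
        Subalgebra.centralizer L ((fun a : Module.End ℚ V => a.baseChange L) '' (H.endAlg : Set (Module.End ℚ V))))
    (hΦ : ∀ f x, ((Φ f).1 : Module.End L (L ⊗[ℚ] V)) (extendScalars K L V x) =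
      extendScalars K L V ((f.1 : Module.End K (K ⊗[ℚ] V)) x))
    (c : Subalgebra.centralizer K ((fun a : Module.End ℚ V => a.baseChange K) '' (H.endAlg : Set (Module.End ℚ V)))) :
    Φ (ψ.centralizerAdjoint K c) = ψ.centralizerAdjoint L (Φ c) := by
  refine Subtype.ext ?_
  rw [Polarization.coe_centralizerAdjoint]
  exact linearMap_eq_of_extendScalars_comm K L V (hΦ _) (fun x => by
    rw [Polarization.coe_centralizerAdjoint]
    exact ψ.adjointBaseChange_extendScalars_comm K L (hΦ c) x)

/-- **`Φ` RESPECTS `†`-SYMMETRY AND `†`-UNITARITY**: `Φ(c)† = Φ(c) ⟺ c† = c` and `Φ(c)† Φ(c) = 1 ⟺ c† c = 1` — the symmetric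
elements (Prop. 1.3) and the unitary elements (`S(A)(k) ⊆ C(A)`) of `(C(A) ⊗ k, †)` correspond along `k ⊆ k'`.
[cite: Milne1999LefschetzClasses, §1 Prop. 1.3 (p. 643), p. 644 L16–L20 and Remark 1.6 (p. 644)] -/
theorem Polarization.centralizerAdjoint_map_eq_iff_of_extendScalars_comm {H : HodgeStructure V n} (ψ : Polarization H)
    (Φ : Subalgebra.centralizer K ((fun a : Module.End ℚ V => a.baseChange K) '' (H.endAlg : Set (Module.End ℚ V))) →+*
        Subalgebra.centralizer L ((fun a : Module.End ℚ V => a.baseChange L) '' (H.endAlg : Set (Module.End ℚ V))))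
    (hΦ : ∀ f x, ((Φ f).1 : Module.End L (L ⊗[ℚ] V)) (extendScalars K L V x) =
      extendScalars K L V ((f.1 : Module.End K (K ⊗[ℚ] V)) x))
    (c : Subalgebra.centralizer K ((fun a : Module.End ℚ V => a.baseChange K) '' (H.endAlg : Set (Module.End ℚ V)))) :
    (ψ.centralizerAdjoint L (Φ c) = Φ c ↔ ψ.centralizerAdjoint K c = c) ∧
      (ψ.centralizerAdjoint L (Φ c) * Φ c = 1 ↔ ψ.centralizerAdjoint K c * c = 1) := by
  constructor
  · rw [Subtype.ext_iff, Subtype.ext_iff, Polarization.coe_centralizerAdjoint, Polarization.coe_centralizerAdjoint]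
    exact ψ.adjointBaseChange_eq_self_iff_of_extendScalars_comm K L (hΦ c)
  · rw [Subtype.ext_iff, Subtype.ext_iff, Subalgebra.coe_mul, Subalgebra.coe_mul, Subalgebra.coe_one, Subalgebra.coe_one,
      Polarization.coe_centralizerAdjoint, Polarization.coe_centralizerAdjoint]
    exact ψ.adjointBaseChange_mul_self_eq_one_iff_of_extendScalars_comm K L (hΦ c)

omit [Module.Finite ℚ V] in
/-- **`Φ` CARRIES `S(H)(K) = {γ ∈ C(H)(K) | γ†γ = 1}` TO `S(H)(L)` CONSISTENTLY WITH `γ ↦ γ_L`**: for `γ ∈ S(H)(K)` (so `↑γ ∈ C(H)(K)`),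
`Φ(↑γ) = ↑(γ_L)`. [cite: Milne1999LefschetzClasses, §1 p. 644 L16–L20 and Remark 1.6 (p. 644)] -/
theorem Polarization.map_coe_eq_coe_glExtendScalars {H : HodgeStructure V n} (ψ : Polarization H)
    (Φ : Subalgebra.centralizer K ((fun a : Module.End ℚ V => a.baseChange K) '' (H.endAlg : Set (Module.End ℚ V))) →+*
        Subalgebra.centralizer L ((fun a : Module.End ℚ V => a.baseChange L) '' (H.endAlg : Set (Module.End ℚ V))))
    (hΦ : ∀ f x, ((Φ f).1 : Module.End L (L ⊗[ℚ] V)) (extendScalars K L V x) =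
      extendScalars K L V ((f.1 : Module.End K (K ⊗[ℚ] V)) x))
    (γ : ψ.lefschetzGroupBaseChange K)
    (hγ : ((γ : (K ⊗[ℚ] V) ≃ₗ[K] (K ⊗[ℚ] V)) : Module.End K (K ⊗[ℚ] V)) ∈ Subalgebra.centralizer K
      ((fun a : Module.End ℚ V => a.baseChange K) '' (H.endAlg : Set (Module.End ℚ V)))) :
    ((Φ ⟨((γ : (K ⊗[ℚ] V) ≃ₗ[K] (K ⊗[ℚ] V)) : Module.End K (K ⊗[ℚ] V)), hγ⟩).1 : Module.End L (L ⊗[ℚ] V)) =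
      ((glExtendScalars K L V (γ : (K ⊗[ℚ] V) ≃ₗ[K] (K ⊗[ℚ] V)) : (L ⊗[ℚ] V) ≃ₗ[L] (L ⊗[ℚ] V)) : Module.End L (L ⊗[ℚ] V)) :=
  linearMap_eq_of_extendScalars_comm K L V (hΦ _) (coe_glExtendScalars_extendScalars K L V _)

omit [Module.Finite ℚ V] in
/-- **`↑γ ∈ C(H)(K)` for `γ ∈ S(H)(K)`** («`γ ∈ C(A) ⊗_k R`»; public spelling of the private tree lemma). [cite: Milne1999LefschetzClasses, §1 p. 644 L16–L20] -/
theorem Polarization.coe_mem_centralizer_endAlg_baseChange {H : HodgeStructure V n} (ψ : Polarization H)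
    (γ : ψ.lefschetzGroupBaseChange K) :
    ((γ : (K ⊗[ℚ] V) ≃ₗ[K] (K ⊗[ℚ] V)) : Module.End K (K ⊗[ℚ] V)) ∈ Subalgebra.centralizer K
      ((fun a : Module.End ℚ V => a.baseChange K) '' (H.endAlg : Set (Module.End ℚ V))) := by
  rw [Subalgebra.mem_centralizer_iff]
  rintro _ ⟨a, ha, rfl⟩
  exact LinearMap.ext fun x => ψ.baseChange_endAlg_apply_of_mem_lefschetzGroupBaseChange γ.2 ⟨a, ha⟩ x

set_option maxSynthPendingDepth 4 in
/-- **`Φ` MAPS THE CENTRE TO THE CENTRE AND DETECTS IT: `Φ(c) ∈ Z(C(H)(L)) ⟺ c ∈ Z(C(H)(K))`** (polarizable `H`; g56-#1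
`mem_center_centralizer_iff_of_extendScalars_comm`) — `Φ` restricts to the ring homomorphism `C₀ ⊗ K → C₀ ⊗ L` of g56-#1.
[cite: Milne1999LefschetzClasses, §1 Remark 1.6 (p. 644) and p. 645 L2–L6 (`C₀`)] -/
theorem map_mem_center_centralizer_iff_of_extendScalars_comm (hH : H.IsPolarizable)
    (Φ : Subalgebra.centralizer K ((fun a : Module.End ℚ V => a.baseChange K) '' (H.endAlg : Set (Module.End ℚ V))) →+*
        Subalgebra.centralizer L ((fun a : Module.End ℚ V => a.baseChange L) '' (H.endAlg : Set (Module.End ℚ V))))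
    (hΦ : ∀ f x, ((Φ f).1 : Module.End L (L ⊗[ℚ] V)) (extendScalars K L V x) =
      extendScalars K L V ((f.1 : Module.End K (K ⊗[ℚ] V)) x))
    (c : Subalgebra.centralizer K ((fun a : Module.End ℚ V => a.baseChange K) '' (H.endAlg : Set (Module.End ℚ V)))) :
    Φ c ∈ Subalgebra.center L (Subalgebra.centralizer L
        ((fun a : Module.End ℚ V => a.baseChange L) '' (H.endAlg : Set (Module.End ℚ V)))) ↔
      c ∈ Subalgebra.center K (Subalgebra.centralizer K
        ((fun a : Module.End ℚ V => a.baseChange K) '' (H.endAlg : Set (Module.End ℚ V)))) := by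
  have h := mem_center_centralizer_iff_of_extendScalars_comm K L H hH (hΦ c) c.2
  have hc : (⟨(Φ c).1, (mem_centralizer_endAlg_baseChange_iff_of_extendScalars_comm K L H (hΦ c)).2 c.2⟩ :
      Subalgebra.centralizer L ((fun a : Module.End ℚ V => a.baseChange L) '' (H.endAlg : Set (Module.End ℚ V)))) = Φ c :=
    Subtype.ext rfl
  rw [hc] at h
  rw [h]

end Algebra

end HodgeStructure

end Literature.AlgebraicGeometry.Motives
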